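import Mathlib
import Literature.Probability.Percolation.Percolation
import Literature.Probability.Percolation.CornerPercolation
import Literature.Probability.Percolation.SelfRefinementMeasure
import Literature.Probability.LatticeModels.IsoradialPercolation
import Literature.Probability.LatticeModels.TriangularLattice
import Literature.MathematicalPhysics.QuantumLattice.KagomeLattice
import Literature.MathematicalPhysics.QuantumLattice.KagomeLatticeProofs
import Summits.CriticalPhenomena.CardyFormulaZ2.Theorems.CardyMagicRigidityHexSegmentDefs
import HarnessLib

/-!
# Stub `stub_bondEnd` (S1) of line `Sketch`, crux `LoopLimitZ2EqT` (stmt-CriticalPhenomena-4833)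

**Endpoint law identity at `t = 1`** of the hex-segment model: the pushforward of the coin measure
`prodBernoulli (prm 1)` under the coin-to-bond map `cfg` is i.i.d. critical bond percolation on the
triangular lattice, `bondPercolation triGraph (criticalWeightI (π/6)) = setBer(triGraph.edgeSet, p_c)`.

Proof (the template is the endpoint computation `selfRefinementMeasure_zero_half` of
`Literature/Probability/Percolation/SelfRefinementMeasure.lean`).
* Under `prm 1` the type bit `(x, none)` of every cell has parameter `1`, hence is almost surely
  present (`prodBernoulli_ae_mem`); `Site 2` is countable, so almost surely ALL type bits are
  present, and then `cfg S` is the image under `(x, k) ↦ upEdge x k` of the bond-coin layer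
  `{(x, k) | (x, some (some k)) ∈ S}` (`bondEnd_cfg_eq_image`). By `Measure.map_congr` the law of
  `cfg` is the law of this composite.
* The bond-coin layer is the preimage of `S` along the injection `(x, k) ↦ (x, some (some k))`, so
  its law is `prodBernoulli` with the constant parameter `p_c` (`prodBernoulli_map_preimage`), i.e.
  Mathlib's `setBer(univ, p_c)` (`prodBernoulli_const`).
* `upEdge x k` is the kagome edge `kagomeEdge (x, k)` of
  `Literature/MathematicalPhysics/QuantumLattice/KagomeLattice.lean` (the edge of `𝕋` whose midpoint
  is the kagome site `(x, k)`), and `kagomeEdge : ℤ² × Fin 3 → Sym2 ℤ²` is injective with range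
  `triGraph.edgeSet` (`kagomeEdge_injective`, `kagomeEdge_mem_edgeSet`,
  `exists_kagomeEdge_eq_of_mem_edgeSet`); the image of `setBer(univ, p_c)` under an injection is
  `setBer(range, p_c)` (`setBernoulli_univ_map_image`), which is `bondPercolation triGraph p_c`.
-/

noncomputable section

open MeasureTheory Set ProbabilityTheory

namespace Summit.CriticalPhenomena.CardyFormulaZ2.Cruxes.LoopLimitZ2EqT.HexSegment

open Literature.Probability.Percolation Literature.Probability.LatticeModels
open Literature.MathematicalPhysics.QuantumLattice (kagomeEdge kagomeEdge_injective
  kagomeEdge_mem_edgeSet exists_kagomeEdge_eq_of_mem_edgeSet)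

/-! ### `upEdge` is the kagome edge map, a bijection `ℤ² × Fin 3 ≃ E(𝕋)` -/

/-- `upEdge x k` is the edge `kagomeEdge (x, k)` of `𝕋` whose midpoint is the kagome site `(x, k)`:
`{x, x + e₀}`, `{x, x + e₁}`, `{x + e₀, x + e₁}` for `k = 0, 1, 2`. -/
theorem bondEnd_upEdge_eq_kagomeEdge (x : Site 2) (k : Fin 3) : upEdge x k = kagomeEdge (x, k) := by
  fin_cases k <;>
    simp [upEdge, kagomeEdge, vec10_eq_single, vec01_eq_single]

/-- The range of `kagomeEdge` is the edge set of the triangular lattice `𝕋 = triGraph`. -/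
theorem bondEnd_range_kagomeEdge : Set.range kagomeEdge = triGraph.edgeSet := by
  ext e
  constructor
  · rintro ⟨v, rfl⟩
    exact kagomeEdge_mem_edgeSet v
  · exact fun he => exists_kagomeEdge_eq_of_mem_edgeSet e he

/-- The image map `S ↦ f '' S` along an injection `f` is measurable (coordinate `f a` of the image
is coordinate `a`; coordinates off the range are constantly absent). -/
theorem bondEnd_measurable_image {α β : Type*} {f : α → β} (hf : Function.Injective f) :
    Measurable fun S : Set α => f '' S := by
  refine measurable_set_iff.2 fun b => ?_
  by_cases hb : b ∈ Set.range f
  · obtain ⟨a, rfl⟩ := hb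
    have h : (fun S : Set α => f a ∈ f '' S) = fun S => a ∈ S :=
      funext fun S => propext hf.mem_set_image
    rw [h]
    exact measurable_set_mem a
  · have h : (fun S : Set α => b ∈ f '' S) = fun _ => False :=
      funext fun S => propext ⟨fun ⟨a, _, ha⟩ => hb ⟨a, ha⟩, False.elim⟩
    rw [h]
    exact measurable_const

/-! ### The bond-coin layer at `t = 1` -/

/-- The embedding `(x, k) ↦ (x, some (some k))` of the bond-coin labels into the coins is
injective. -/
theorem bondEnd_bondCoin_injective :
    Function.Injective fun i : Site 2 × Fin 3 => ((i.1, some (some i.2)) : Coin) := by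
  rintro ⟨x, k⟩ ⟨y, l⟩ h
  simp only [Prod.mk.injEq, Option.some.injEq] at h
  rw [h.1, h.2]

/-- At `t = 1` every type bit `(x, none)` has parameter `1`, so almost surely all type bits are
present (countably many coordinate events of full measure). -/
theorem bondEnd_ae_forall_type_mem :
    ∀ᵐ S ∂prodBernoulli (prm 1), ∀ x : Site 2, ((x, none) : Coin) ∈ S := by
  have h : ∀ x : Site 2, ∀ᵐ S ∂prodBernoulli (prm 1), ((x, none) : Coin) ∈ S :=
    fun x => prodBernoulli_ae_mem _ rfl
  exact ae_all_iff.2 h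

/-- With all type bits present, every cell is of bond type and `cfg S` is the `kagomeEdge`-image of
the bond-coin layer `{(x, k) | (x, some (some k)) ∈ S}`. -/
theorem bondEnd_cfg_eq_image {S : Set Coin} (hS : ∀ x : Site 2, ((x, none) : Coin) ∈ S) :
    cfg S = kagomeEdge '' ((fun i : Site 2 × Fin 3 => ((i.1, some (some i.2)) : Coin)) ⁻¹' S) := by
  ext e
  simp only [cfg, Set.mem_setOf_eq, Set.mem_image, Set.mem_preimage]
  constructor
  · rintro ⟨x, k, rfl, h⟩
    refine ⟨(x, k), ?_, (bondEnd_upEdge_eq_kagomeEdge x k).symm⟩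
    rcases h with ⟨-, h⟩ | ⟨h, -⟩
    · exact h
    · exact absurd (hS x) h
  · rintro ⟨⟨x, k⟩, h, rfl⟩
    exact ⟨x, k, (bondEnd_upEdge_eq_kagomeEdge x k).symm, Or.inl ⟨hS x, h⟩⟩

/-- The law of the bond-coin layer at `t = 1` is the homogeneous product Bernoulli measure with
parameter `p_c(𝕋̃) = criticalWeightI (π/6)`. -/
theorem bondEnd_map_bondCoinLayer :
    (prodBernoulli (prm 1)).map
        (fun S : Set Coin => (fun i : Site 2 × Fin 3 => ((i.1, some (some i.2)) : Coin)) ⁻¹' S) =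
      setBer((Set.univ : Set (Site 2 × Fin 3)), criticalWeightI (Real.pi / 6)) := by
  rw [prodBernoulli_map_preimage (prm 1) bondEnd_bondCoin_injective]
  exact prodBernoulli_const (criticalWeightI (Real.pi / 6))

/-! ### S1 -/

/-- **S1 `BondEndLaw` (endpoint dictionary at `t = 1`).** Under `prm 1` every cell is almost
surely of bond type, `upEdge` is a bijection `ℤ² × Fin 3 ≃ E(𝕋)`, and the bond coins are i.i.d. of
density `p_c(𝕋̃) = criticalWeightI (π/6)`: the law of `cfg` is i.i.d. critical bond percolation
`bondPercolation triGraph (criticalWeightI (π/6))` on the triangular lattice. -/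
theorem stub_bondEnd : BondEndLaw := by
  have hae : cfg =ᵐ[prodBernoulli (prm 1)]
      (fun T : Set (Site 2 × Fin 3) => kagomeEdge '' T) ∘
        (fun S : Set Coin => (fun i : Site 2 × Fin 3 => ((i.1, some (some i.2)) : Coin)) ⁻¹' S) := by
    filter_upwards [bondEnd_ae_forall_type_mem] with S hS
    exact bondEnd_cfg_eq_image hS
  have hmeasP : Measurable fun S : Set Coin =>
      (fun i : Site 2 × Fin 3 => ((i.1, some (some i.2)) : Coin)) ⁻¹' S :=
    measurable_set_iff.2 fun a => measurable_set_mem _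
  rw [BondEndLaw, Measure.map_congr hae,
    ← Measure.map_map (bondEnd_measurable_image kagomeEdge_injective) hmeasP,
    bondEnd_map_bondCoinLayer, setBernoulli_univ_map_image kagomeEdge_injective,
    bondEnd_range_kagomeEdge]
  rfl

end Summit.CriticalPhenomena.CardyFormulaZ2.Cruxes.LoopLimitZ2EqT.HexSegment

end
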